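import Literature.Analysis.FluidPDE.PeriodicCylinderNeumannWeakTangential
import HarnessLib

/-!
# Radial weak derivatives of the weak periodic Neumann solution on the cylinder

Topic `Literature/Analysis/FluidPDE`. Theorem-only file (no definitions, no named facts): the
**normal (radial) regularity step** of the regularity theory for the weak periodic Neumann problem
on the cylinder `{r ≤ 1} × ℝ/Lℤ` (`PeriodicCylinderHelmholtz`, `…Symmetry`, `…NeumannCovariance`,
`…DifferenceQuotients`, `…NeumannWeakTangential`), the analytic input of the local existence
theorem for the Euler equations in the periodic cylinder (T. Kato, C. Y. Lai, J. Funct. Anal. **56**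
(1984), Thm I/II; named fact `Literature.Analysis.FluidPDE.KatoLai1984_periodicCylinderUniformExistence`).
As in every boundary-regularity proof (Nirenberg 1955; Kato–Lai §4 (i) and [14, Thm 5.5.2]) the
normal derivatives are recovered **from the equation** once the tangential ones are known.

Let `∇q = ∇q[h₀, h₁] ∈ 𝓖` be the weak Neumann solution for smooth `L`-periodic data (`∫_cell h₀ = 0`),
and `g_P = ⟪x_h, ∇q⟫`, `g_J = ⟪Jx, ∇q⟫`, `g_z = ⟪e_z, ∇q⟫` its frame components (`x_h = (x₀,x₁,0)`,
`J x = (−x₁,x₀,0)`); write `P = x_h·∇` (`horizontalProj`, `div P = 2`), `ρ = ‖x_h‖² = r²`. On the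
open cell, in the sense of `HasWeakDerivAlong`:

* `hasWeakDerivAlong_horizontalProj_inner_horizontalProj` —
  **`P g_P = ρ (div h₁ − h₀) − ⟪Jx, ∇q[∂_J h₀, ∂_J h₁ − Jh₁]⟫ − ρ ⟪e_z, ∇q[∂_z h₀, ∂_z h₁]⟫`**: the weak
  equation (`setIntegral_fderiv_coe_neumannGrad`, the tested form of `PeriodicCylinderHelmholtz` on
  the periodisation of an interior test function) tested with `ρφ`, the frame decomposition
  `ρ v = ⟪x_h,v⟫ x_h + ⟪Jx,v⟫ Jx + ρ⟪e_z,v⟫ e_z` (`rsq_smul_eq_frame`), the tangential weak derivatives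
  of `g_J`, `g_z` (the pairing theorems of the preceding file) and the classical divergence identity
  for `h₁` (`setIntegral_fderiv_apply_eq_neg_divergence`, from `MeyersSerrin.hasWeakFDerivOn_of_contDiffOn`);
  this is the weak form of the polar identity `(x_h·∇)²q = r²(Δq − ∂_z²q) − ∂_J²q`
  (tree: `cylDeriv_P_P_eq`);
* `hasWeakDerivAlong_horizontalProj_inner_rotGen`, `hasWeakDerivAlong_horizontalProj_inner_eZ` —
  **`P g_J = ⟪x_h, ∇q[∂_J h₀, ∂_J h₁ − Jh₁]⟫`, `P g_z = ⟪x_h, ∇q[∂_z h₀, ∂_z h₁]⟫`**: weakly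
  `P(Jq) = J(Pq)` and `P(∂_z q) = ∂_z(Pq)` (`hasWeakDerivAlong_horizontalProj_of_comm`: the fields
  commute classically on test functions, `fderiv_P_J_comm`, `fderiv_P_eZ_comm`, by the symmetry of
  second derivatives), and `J(Pq)`, `∂_z(Pq)` are the pairings of the preceding file.

Together with the tangential theorems, every frame derivative (`P`, `J`, `∂_z`) of every frame
component of `∇q[h₀,h₁]` exists weakly on the open cell and is a combination, with polynomial
coefficients, of the smooth data and of frame components of weak solutions `∇q[h₀',h₁']` with
again smooth periodic (differentiated) data — the input of the all-orders induction (sequel file).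

Mathlib/tree search: `fderiv_clm_apply`, `ContDiffAt.isSymmSndFDerivAt`, `HasFDerivAt.norm_sq`,
`HasCompactSupport.mono'`, `MeyersSerrin.hasWeakFDerivOn_of_contDiffOn`, `HasWeakFDerivOn.integral_fderiv_smul_eq`,
`divergence_eq_sum_inner_fderiv`, tree `divergence_horizontalProj`, `divergence_rotGen_eq_zero`,
`horizontalProj_rotGen`, `rotGen_horizontalProj`, `inner_rotGen_left`, `cylRadius_sq`, `norm_horizontalProj`,
`hasWeakFDerivOn_potential`, `HasWeakFDerivOn.hasWeakDerivAlong`, `contDiff_periodize`,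
`fderiv_periodize_eq`, `setIntegral_inner_neumannGrad_cylGrad`. Nothing on normal regularity of a
weak Neumann solution existed in the tree (its `PeriodicCylinderFrameWords`/`…WallWords` are a-priori
identities for smooth functions).

## References

* L. Nirenberg, Comm. Pure Appl. Math. 8 (1955) 649–675. [folklore]
* L. C. Evans, *Partial Differential Equations*, 2nd ed. (2010), §6.3.2 (boundary regularity: normal
  derivatives from the equation). [Evans2010]
* T. Kato, C. Y. Lai, J. Funct. Anal. 56 (1984) 15–28, §4 (i), §5. [KatoLai1984]
-/

noncomputable section

open MeasureTheory Set Function Filter Topology TopologicalSpace WithLp Metric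
open scoped ContDiff NNReal ENNReal InnerProductSpace RealInnerProductSpace

namespace Literature.Analysis.FluidPDE

open Literature.Analysis.FunctionSpaces

/-- Local notation for physical space `ℝ³ = EuclideanSpace ℝ (Fin 3)`. -/
local notation "ℝ³" => EuclideanSpace ℝ (Fin 3)

/-- Local notation for the closed unit cylinder `{r ≤ 1}`. -/
local notation "𝕂" => closure (SetLike.coe unitCylinder : Set (EuclideanSpace ℝ (Fin 3)))

namespace PeriodicCylinder

variable {L : ℝ}

/-! ### The fields of the frame and the square radius -/

/-- The square radius `ρ(x) = ‖x_h‖² = r²` is smooth. [folklore] -/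
theorem contDiff_rsq : ContDiff ℝ ∞ fun x : ℝ³ => ‖horizontalProj x‖ ^ 2 :=
  (horizontalProjL.contDiff).norm_sq ℝ

/-- `ρ = r² = x₀² + x₁²`. [folklore] -/
theorem rsq_eq (x : ℝ³) : ‖horizontalProj x‖ ^ 2 = x 0 ^ 2 + x 1 ^ 2 := by
  rw [norm_horizontalProj, cylRadius_sq]

/-- `⟪x_h, v_h⟫ = ⟪x_h, v⟫`. [folklore] -/
theorem inner_horizontalProj_horizontalProj (x v : ℝ³) : ⟪horizontalProj x, horizontalProj v⟫ = ⟪horizontalProj x, v⟫ := by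
  simp [horizontalProj_apply_eq, Fin.sum_univ_three, inner]

/-- `Dρ(x) v = 2⟪x_h, v⟫`. [folklore] -/
theorem fderiv_rsq_apply (x v : ℝ³) :
    fderiv ℝ (fun y : ℝ³ => ‖horizontalProj y‖ ^ 2) x v = 2 * ⟪horizontalProj x, v⟫ := by
  have h := (horizontalProjL.hasFDerivAt (x := x)).norm_sq
  rw [show (fun y : ℝ³ => ‖horizontalProj y‖ ^ 2) = fun y => ‖horizontalProjL y‖ ^ 2 from rfl, h.fderiv]
  simp only [_root_.FunLike.coe_smul, Pi.smul_apply, ContinuousLinearMap.comp_apply, innerSL_apply_apply]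
  rw [show horizontalProjL x = horizontalProj x from rfl, show horizontalProjL v = horizontalProj v from rfl,
    inner_horizontalProj_horizontalProj]
  norm_num

/-- `ρ` does not depend on `z`. [folklore] -/
theorem fderiv_rsq_apply_eZ (x : ℝ³) : fderiv ℝ (fun y : ℝ³ => ‖horizontalProj y‖ ^ 2) x eZ = 0 := by
  rw [fderiv_rsq_apply, horizontalProj_apply_eq]
  simp [inner, eZ_eq_single]

/-- `x_h` is rotation equivariant. [folklore] -/
theorem horizontalProj_rotZ (θ : ℝ) (x : ℝ³) : horizontalProj (rotZ θ x) = rotZ θ (horizontalProj x) := by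
  ext i; fin_cases i <;> simp [horizontalProj_apply_eq]

/-- `x_h` does not depend on `z`: `D(x_h)(x) e_z = 0`. [folklore] -/
theorem fderiv_horizontalProj_apply_eZ (x : ℝ³) : fderiv ℝ (fun y : ℝ³ => horizontalProj y) x eZ = 0 := by
  rw [fderiv_horizontalProj]
  show horizontalProj eZ = 0
  ext i; fin_cases i <;> simp [horizontalProj_apply_eq, eZ_eq_single]

/-- `J x` does not depend on `z`: `DJ(x) e_z = 0`. [folklore] -/
theorem fderiv_rotGen_apply_eZ (x : ℝ³) : fderiv ℝ rotGen x eZ = 0 := by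
  rw [fderiv_rotGen]
  show rotGenL eZ = 0
  ext i; fin_cases i <;> simp [rotGenL_apply, rotGen, eZ_eq_single]

/-- `‖x_h‖ ≤ 1` on the cell. [folklore] -/
theorem norm_horizontalProj_le_one {x : ℝ³} (hx : x ∈ (cylinderCell L : Set ℝ³)) : ‖horizontalProj x‖ ≤ 1 := by
  rw [norm_horizontalProj]; exact hx.1.le

/-- `‖J x‖ ≤ 1` on the cell. [folklore] -/
theorem norm_rotGen_le_one {x : ℝ³} (hx : x ∈ (cylinderCell L : Set ℝ³)) : ‖rotGen x‖ ≤ 1 := by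
  rw [norm_rotGen_eq_cylRadius]; exact hx.1.le

/-- **The frame decomposition of `ρ v`**: `ρ v = ⟪x_h, v⟫ x_h + ⟪Jx, v⟫ Jx + ρ ⟪e_z, v⟫ e_z`. [folklore] -/
theorem rsq_smul_eq_frame (x v : ℝ³) :
    (‖horizontalProj x‖ ^ 2) • v = ⟪horizontalProj x, v⟫ • horizontalProj x + ⟪rotGen x, v⟫ • rotGen x +
      ((‖horizontalProj x‖ ^ 2) * ⟪(eZ : ℝ³), v⟫) • (eZ : ℝ³) := by
  have hh : ⟪horizontalProj x, v⟫ = x 0 * v 0 + x 1 * v 1 := by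
    rw [horizontalProj_apply_eq]; simp [Fin.sum_univ_three, inner]; ring
  have hj : ⟪rotGen x, v⟫ = x 0 * v 1 - x 1 * v 0 := inner_rotGen_left x v
  have he : ⟪(eZ : ℝ³), v⟫ = v 2 := by simp [eZ_eq_single, inner]
  rw [hh, hj, he, rsq_eq]
  ext i
  fin_cases i <;> simp [horizontalProj_apply_eq, rotGen, eZ_eq_single] <;> ring

/-! ### Second derivatives along commuting fields commute -/

/-- For a `C²` function and linear fields `A`, `B` with `A(Bx) = B(Ax)`, the classical derivatives
along `A` and `B` commute: `∂_B ∂_A φ = ∂_A ∂_B φ`. [folklore] -/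
theorem fderiv_fderiv_linear_comm {φ : ℝ³ → ℝ} (hφ : ContDiff ℝ 2 φ) (A B : ℝ³ →L[ℝ] ℝ³)
    (hAB : ∀ x, A (B x) = B (A x)) (x : ℝ³) :
    fderiv ℝ (fun y => fderiv ℝ φ y (A y)) x (B x) = fderiv ℝ (fun y => fderiv ℝ φ y (B y)) x (A x) := by
  have hd : Differentiable ℝ (fderiv ℝ φ) := (hφ.fderiv_right (m := 1) (by norm_num)).differentiable one_ne_zero
  rw [fderiv_clm_apply (hd x) A.differentiableAt, fderiv_clm_apply (hd x) B.differentiableAt]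
  simp only [_root_.add_apply, ContinuousLinearMap.comp_apply, ContinuousLinearMap.flip_apply,
    ContinuousLinearMap.fderiv]
  rw [hAB x, (hφ.contDiffAt.isSymmSndFDerivAt (by simp)).eq (B x) (A x), add_comm]

/-- For a `C²` function, a linear field `A` and a constant direction `c` with `A c = 0`:
`∂_c ∂_A φ = ∂_A ∂_c φ`. [folklore] -/
theorem fderiv_fderiv_linear_const_comm {φ : ℝ³ → ℝ} (hφ : ContDiff ℝ 2 φ) (A : ℝ³ →L[ℝ] ℝ³) (c : ℝ³)
    (hAc : A c = 0) (x : ℝ³) :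
    fderiv ℝ (fun y => fderiv ℝ φ y (A y)) x c = fderiv ℝ (fun y => fderiv ℝ φ y c) x (A x) := by
  have hd : Differentiable ℝ (fderiv ℝ φ) := (hφ.fderiv_right (m := 1) (by norm_num)).differentiable one_ne_zero
  rw [fderiv_clm_apply (hd x) A.differentiableAt, fderiv_clm_apply (hd x) (differentiableAt_const c),
    fderiv_const_apply]
  simp only [_root_.add_apply, ContinuousLinearMap.comp_apply, ContinuousLinearMap.flip_apply,
    ContinuousLinearMap.fderiv, _root_.zero_apply, hAc, map_zero]
  rw [(hφ.contDiffAt.isSymmSndFDerivAt (by simp)).eq c (A x), zero_add]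

/-! ### Test functions derived from a test function -/

/-- `x ↦ Dφ(x)(X x)` is a test function on `Ω` for a test function `φ` and a smooth field `X`. [folklore] -/
theorem isTestFunctionOn_fderiv_apply_field {Ω : Opens ℝ³} {φ : ℝ³ → ℝ} (hφ : IsTestFunctionOn Ω φ)
    {X : ℝ³ → ℝ³} (hX : ContDiff ℝ ∞ X) : IsTestFunctionOn Ω fun x => fderiv ℝ φ x (X x) := by
  have hsupp : support (fun x => fderiv ℝ φ x (X x)) ⊆ tsupport φ := fun x hx => by
    by_contra h
    exact hx (by simp [fderiv_of_notMem_tsupport ℝ h])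
  refine ⟨(hφ.contDiff.fderiv_right (m := ∞) (by simp)).clm_apply hX, hφ.hasCompactSupport.mono' hsupp, ?_⟩
  exact (closure_minimal hsupp (isClosed_tsupport φ)).trans hφ.tsupport_subset

/-- The test factor `Dφ(x_h) + 2φ` of the radial field is a test function. [folklore] -/
theorem isTestFunctionOn_radialFactor {Ω : Opens ℝ³} {φ : ℝ³ → ℝ} (hφ : IsTestFunctionOn Ω φ) :
    IsTestFunctionOn Ω fun x => fderiv ℝ φ x (horizontalProj x) + 2 * φ x := by
  have h1 := isTestFunctionOn_fderiv_apply_field hφ horizontalProjL.contDiff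
  have hsupp : support (fun x => fderiv ℝ φ x (horizontalProj x) + 2 * φ x) ⊆ tsupport φ := fun x hx => by
    by_contra h
    exact hx (by simp [fderiv_of_notMem_tsupport ℝ h, image_eq_zero_of_notMem_tsupport h])
  refine ⟨h1.contDiff.add (contDiff_const.mul hφ.contDiff), hφ.hasCompactSupport.mono' hsupp, ?_⟩
  exact (closure_minimal hsupp (isClosed_tsupport φ)).trans hφ.tsupport_subset

/-- `ρφ` is a test function. [folklore] -/
theorem isTestFunctionOn_rsq_mul {Ω : Opens ℝ³} {φ : ℝ³ → ℝ} (hφ : IsTestFunctionOn Ω φ) :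
    IsTestFunctionOn Ω fun x => φ x * ‖horizontalProj x‖ ^ 2 :=
  hφ.mul_contDiff contDiff_rsq

/-! ### Integrability of test-function multiples of locally integrable functions -/

/-- A test function on the cell times a locally integrable function is integrable on the cell.
[folklore] -/
theorem integrable_testFunction_mul {φ : ℝ³ → ℝ} (hφ : IsTestFunctionOn (cylinderCell L) φ) {g : ℝ³ → ℝ}
    (hg : LocallyIntegrableOn g (cylinderCell L : Set ℝ³) volume) :
    Integrable (fun x => φ x * g x) (cellMeasure L) := by
  have h : IntegrableOn (fun x => φ x • g x) (cylinderCell L : Set ℝ³) volume :=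
    integrableOn_smul_of_tsupport_subset hφ.contDiff.continuous hφ.hasCompactSupport hφ.tsupport_subset hg
  exact h

/-- A test function on the cell paired against a locally integrable field is integrable on the cell.
[folklore] -/
theorem integrable_testFunction_smul {φ : ℝ³ → ℝ} (hφ : IsTestFunctionOn (cylinderCell L) φ) {g : ℝ³ → ℝ³}
    (hg : LocallyIntegrableOn g (cylinderCell L : Set ℝ³) volume) :
    Integrable (fun x => φ x • g x) (cellMeasure L) :=
  integrableOn_smul_of_tsupport_subset hφ.contDiff.continuous hφ.hasCompactSupport hφ.tsupport_subset hg

/-- An `L²(cell)` class is locally integrable on the cell. [folklore] -/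
theorem locallyIntegrableOn_coe {E : Type*} [NormedAddCommGroup E] (u : Lp E 2 (cellMeasure L)) :
    LocallyIntegrableOn (u : ℝ³ → E) (cylinderCell L : Set ℝ³) volume :=
  (show IntegrableOn (u : ℝ³ → E) (cylinderCell L : Set ℝ³) volume from
    (Lp.memLp u).integrable one_le_two).locallyIntegrableOn

/-- A pairing `⟪V, u⟫` of an `L²(cell)` class with a continuous field is locally integrable on the cell.
[folklore] -/
theorem locallyIntegrableOn_inner_coe {V : ℝ³ → ℝ³} (hV : Continuous V) (u : Lp ℝ³ 2 (cellMeasure L)) :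
    LocallyIntegrableOn (fun x => ⟪V x, (u : ℝ³ → ℝ³) x⟫) (cylinderCell L : Set ℝ³) volume := by
  have h := locallyIntegrableOn_coe u
  rw [MeasureTheory.locallyIntegrableOn_iff (cylinderCell L).isOpen.isLocallyClosed] at h ⊢
  intro K hK hKc
  obtain ⟨C, hC⟩ := hKc.exists_bound_of_continuousOn hV.continuousOn
  refine Integrable.mono' ((h K hK hKc).norm.const_mul C) (hV.aestronglyMeasurable.inner
    (h K hK hKc).aestronglyMeasurable) ?_
  filter_upwards [ae_restrict_mem hKc.measurableSet] with x hx
  exact (norm_inner_le_norm _ _).trans (mul_le_mul_of_nonneg_right (hC x hx) (norm_nonneg _))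

/-! ### The weak equation on the cell and the classical divergence identity for the data -/

/-- **The weak Neumann equation tested with interior test functions**: for smooth periodic data with
`∫_cell h₀ = 0` and every test function `φ` on the cell,
`∫_cell Dφ(∇q) = ∫_cell h₀ φ + ∫_cell Dφ(h₁)` — the tested form of `PeriodicCylinderHelmholtz`
(`setIntegral_inner_neumannGrad_cylGrad`) applied to the periodisation of `φ`. [folklore] -/
theorem setIntegral_fderiv_coe_neumannGrad (hL : 0 < L) {h₀ : ℝ³ → ℝ} {h₁ : ℝ³ → ℝ³}
    (hh₀ : IsSmoothPeriodic L h₀) (hh₁ : IsSmoothPeriodic L h₁)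
    (hmean : ∫ x in (cylinderCell L : Set ℝ³), h₀ x = 0) {φ : ℝ³ → ℝ} (hφ : IsTestFunctionOn (cylinderCell L) φ) :
    ∫ x in (cylinderCell L : Set ℝ³), fderiv ℝ φ x ((((neumannGrad L (toCell L h₀) (toCell L h₁) : gradSpace L) :
        Lp ℝ³ 2 (cellMeasure L)) : ℝ³ → ℝ³) x) =
      (∫ x in (cylinderCell L : Set ℝ³), h₀ x * φ x) + ∫ x in (cylinderCell L : Set ℝ³), fderiv ℝ φ x (h₁ x) := by
  have hψ : IsSmoothPeriodic L (periodize L φ) :=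
    ⟨(contDiff_periodize hL hφ).contDiffOn, isAxiallyPeriodic_periodize hL φ⟩
  have hmean' : ∫ x in (cylinderCell L : Set ℝ³), (toCell L h₀ : ℝ³ → ℝ) x = 0 := by
    rw [← hmean]; exact integral_congr_ae (coeFn_toCell hh₀.memLp)
  have h := setIntegral_inner_neumannGrad_cylGrad hL hmean' (toCell L h₁) hψ
  -- convert each integral
  have e1 : ∀ x ∈ (cylinderCell L : Set ℝ³), ∀ v : ℝ³, ⟪v, cylGrad (periodize L φ) x⟫ = fderiv ℝ φ x v := fun x hx v => by
    rw [inner_cylGrad_right, ← cylDeriv_apply (fun _ => v) (periodize L φ) x,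
      cylDeriv_eq_fderiv _ _ (cylinderCell_le_unitCylinder L hx), fderiv_periodize_eq hL hx]
  have hl : ∫ x in (cylinderCell L : Set ℝ³), ⟪((neumannGrad L (toCell L h₀) (toCell L h₁) : gradSpace L) :
      Lp ℝ³ 2 (cellMeasure L)) x, cylGrad (periodize L φ) x⟫ =
      ∫ x in (cylinderCell L : Set ℝ³), fderiv ℝ φ x ((((neumannGrad L (toCell L h₀) (toCell L h₁) : gradSpace L) :
        Lp ℝ³ 2 (cellMeasure L)) : ℝ³ → ℝ³) x) :=
    setIntegral_congr_fun (cylinderCell L).isOpen.measurableSet fun x hx => e1 x hx _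
  have hr0 : ∫ x in (cylinderCell L : Set ℝ³), (toCell L h₀ : ℝ³ → ℝ) x * periodize L φ x =
      ∫ x in (cylinderCell L : Set ℝ³), h₀ x * φ x := by
    refine integral_congr_ae ?_
    filter_upwards [coeFn_toCell hh₀.memLp, ae_restrict_mem (cylinderCell L).isOpen.measurableSet] with x hx hxc
    rw [hx, periodize_eq_self hL φ hxc]
  have hr1 : ∫ x in (cylinderCell L : Set ℝ³), ⟪(toCell L h₁ : ℝ³ → ℝ³) x, cylGrad (periodize L φ) x⟫ =
      ∫ x in (cylinderCell L : Set ℝ³), fderiv ℝ φ x (h₁ x) := by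
    refine integral_congr_ae ?_
    filter_upwards [coeFn_toCell hh₁.memLp, ae_restrict_mem (cylinderCell L).isOpen.measurableSet] with x hx hxc
    rw [hx, e1 x hxc]
  rw [hl, hr0, hr1] at h
  exact h

/-- **The divergence identity for a field smooth on the cell**: `∫_cell Dη(h₁) = −∫_cell (div h₁) η`
for a test function `η` on the cell (the components of `h₁` are weakly differentiable with their
classical derivatives, `MeyersSerrin.hasWeakFDerivOn_of_contDiffOn`). [folklore] -/
theorem setIntegral_fderiv_apply_eq_neg_divergence {h₁ : ℝ³ → ℝ³} (hh₁ : ContDiffOn ℝ ∞ h₁ (cylinderCell L : Set ℝ³))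
    {η : ℝ³ → ℝ} (hη : IsTestFunctionOn (cylinderCell L) η) :
    ∫ x in (cylinderCell L : Set ℝ³), fderiv ℝ η x (h₁ x) =
      -∫ x in (cylinderCell L : Set ℝ³), VectorCalculus.divergence h₁ x * η x := by
  set b := EuclideanSpace.basisFun (Fin 3) ℝ with hb
  have hw := MeyersSerrin.hasWeakFDerivOn_of_contDiffOn (μ := volume) (Ω := cylinderCell L) hh₁
  -- componentwise identities
  have hcomp : ∀ i, ∫ x in (cylinderCell L : Set ℝ³), fderiv ℝ η x (b i) * ⟪(b i : ℝ³), h₁ x⟫ =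
      -∫ x in (cylinderCell L : Set ℝ³), η x * ⟪(b i : ℝ³), fderiv ℝ h₁ x (b i)⟫ := fun i => by
    have key := hw.integral_fderiv_smul_eq η (b i) hη
    have h1 : ∫ x in (cylinderCell L : Set ℝ³), fderiv ℝ η x (b i) * ⟪(b i : ℝ³), h₁ x⟫ =
        ⟪(b i : ℝ³), ∫ x in (cylinderCell L : Set ℝ³), fderiv ℝ η x (b i) • h₁ x⟫ := by
      rw [← integral_inner (integrable_testFunction_smul (isTestFunctionOn_fderiv_apply_field hη contDiff_const)
        hw.locallyIntegrableOn)]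
      exact integral_congr_ae (Eventually.of_forall fun x => by simp only [inner_smul_right])
    have h2 : ∫ x in (cylinderCell L : Set ℝ³), η x * ⟪(b i : ℝ³), fderiv ℝ h₁ x (b i)⟫ =
        ⟪(b i : ℝ³), ∫ x in (cylinderCell L : Set ℝ³), η x • fderiv ℝ h₁ x (b i)⟫ := by
      rw [← integral_inner (integrable_testFunction_smul hη
        (HasWeakDerivAlong.locallyIntegrableOn_clm_apply_of_continuous hw.locallyIntegrableOn_deriv continuous_const))]
      exact integral_congr_ae (Eventually.of_forall fun x => by simp only [inner_smul_right])
    rw [h1, h2, key, inner_neg_right]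
  -- sum over the basis
  have hlhs : ∀ x, fderiv ℝ η x (h₁ x) = ∑ i, fderiv ℝ η x (b i) * ⟪(b i : ℝ³), h₁ x⟫ := fun x => by
    conv_lhs => rw [← b.sum_repr' (h₁ x)]
    rw [map_sum]
    exact Finset.sum_congr rfl fun i _ => by rw [map_smul, smul_eq_mul, mul_comm]
  have hrhs : ∀ x, VectorCalculus.divergence h₁ x * η x = ∑ i, η x * ⟪(b i : ℝ³), fderiv ℝ h₁ x (b i)⟫ := fun x => by
    rw [divergence_eq_sum_inner_fderiv b, Finset.sum_mul]
    exact Finset.sum_congr rfl fun i _ => by ring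
  simp_rw [hlhs, hrhs]
  have I1 : ∀ i, Integrable (fun x => fderiv ℝ η x (b i) * ⟪(b i : ℝ³), h₁ x⟫) (cellMeasure L) := fun i =>
    integrable_testFunction_mul (isTestFunctionOn_fderiv_apply_field hη contDiff_const)
      ((ContinuousLinearMap.locallyIntegrableOn_comp (innerSL ℝ (b i : ℝ³)) hw.locallyIntegrableOn))
  have I2 : ∀ i, Integrable (fun x => η x * ⟪(b i : ℝ³), fderiv ℝ h₁ x (b i)⟫) (cellMeasure L) := fun i =>
    integrable_testFunction_mul hη ((ContinuousLinearMap.locallyIntegrableOn_comp (innerSL ℝ (b i : ℝ³))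
      (HasWeakDerivAlong.locallyIntegrableOn_clm_apply_of_continuous hw.locallyIntegrableOn_deriv continuous_const)))
  rw [integral_finsetSum _ fun i _ => I1 i, integral_finsetSum _ fun i _ => I2 i, ← Finset.sum_neg_distrib]
  exact Finset.sum_congr rfl fun i _ => hcomp i

/-! ### The radial weak derivative of the radial component -/

/-- **The radial weak derivative of `g_P = ⟪x_h, ∇q⟫`** (Kato–Lai's normal regularity from the equation,
in weak form): for smooth periodic data with `∫_cell h₀ = 0`, on the open cell,
`(x_h·∇) g_P = ρ (div h₁ − h₀) − ⟪Jx, ∇q[∂_J h₀, ∂_J h₁ − Jh₁]⟫ − ρ ⟪e_z, ∇q[∂_z h₀, ∂_z h₁]⟫` weakly,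
`ρ = ‖x_h‖² = r²` — the weak equation tested with `ρφ`, the frame decomposition
`ρ Dφ = (x_h·∇φ) x_h + (J·∇φ) J + ρ (∂_zφ) e_z`, and the tangential weak derivatives of
`PeriodicCylinderNeumannWeakTangential.lean`. This is the weak form of the polar identity
`(x_h·∇)² q = r²(Δq − ∂_z² q) − ∂_J² q` of the tree (`cylDeriv_P_P_eq`). [folklore] -/
theorem hasWeakDerivAlong_horizontalProj_inner_horizontalProj (hL : 0 < L) {h₀ : ℝ³ → ℝ} {h₁ : ℝ³ → ℝ³}
    (hh₀ : IsSmoothPeriodic L h₀) (hh₁ : IsSmoothPeriodic L h₁)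
    (hmean : ∫ x in (cylinderCell L : Set ℝ³), h₀ x = 0) :
    HasWeakDerivAlong (cylinderCell L) volume (fun y => horizontalProj y)
      (fun x => ⟪horizontalProj x, (((neumannGrad L (toCell L h₀) (toCell L h₁) : gradSpace L) :
        Lp ℝ³ 2 (cellMeasure L)) : ℝ³ → ℝ³) x⟫)
      (fun x => ‖horizontalProj x‖ ^ 2 * (VectorCalculus.divergence h₁ x - h₀ x)
        - ⟪rotGen x, (((neumannGrad L (toCell L (cylDeriv rotGen h₀))
            (toCell L (fun x => cylDeriv rotGen h₁ x - rotGen (h₁ x))) : gradSpace L) :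
              Lp ℝ³ 2 (cellMeasure L)) : ℝ³ → ℝ³) x⟫
        - ‖horizontalProj x‖ ^ 2 * ⟪(eZ : ℝ³), (((neumannGrad L (toCell L (cylDeriv (fun _ => eZ) h₀))
            (toCell L (cylDeriv (fun _ => eZ) h₁)) : gradSpace L) : Lp ℝ³ 2 (cellMeasure L)) : ℝ³ → ℝ³) x⟫) := by
  -- names for the three classes
  obtain ⟨G, hG⟩ : ∃ G : Lp ℝ³ 2 (cellMeasure L),
      G = ((neumannGrad L (toCell L h₀) (toCell L h₁) : gradSpace L) : Lp ℝ³ 2 (cellMeasure L)) := ⟨_, rfl⟩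
  obtain ⟨GJ, hGJ⟩ : ∃ GJ : Lp ℝ³ 2 (cellMeasure L), GJ = ((neumannGrad L (toCell L (cylDeriv rotGen h₀))
      (toCell L (fun x => cylDeriv rotGen h₁ x - rotGen (h₁ x))) : gradSpace L) : Lp ℝ³ 2 (cellMeasure L)) := ⟨_, rfl⟩
  obtain ⟨GE, hGE⟩ : ∃ GE : Lp ℝ³ 2 (cellMeasure L), GE = ((neumannGrad L (toCell L (cylDeriv (fun _ => eZ) h₀))
      (toCell L (cylDeriv (fun _ => eZ) h₁)) : gradSpace L) : Lp ℝ³ 2 (cellMeasure L)) := ⟨_, rfl⟩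
  rw [← hG, ← hGJ, ← hGE]
  -- the tangential weak derivatives (pairings)
  have hJ := hasWeakDerivAlong_rotGen_inner_neumannGrad hL hh₀ hh₁ (contDiff_rotGen (n := ∞)).continuous rotGen_rotZ
    zero_le_one (fun x hx => norm_rotGen_le_one hx)
  have hE := hasWeakDerivAlong_eZ_inner_neumannGrad hL hh₀ hh₁ (V := fun _ => (eZ : ℝ³)) contDiff_const
    (fun x => by simp)
  rw [← hG, ← hGJ] at hJ
  rw [← hG, ← hGE] at hE
  -- local integrability
  have hPc : ContDiff ℝ ∞ fun y : ℝ³ => horizontalProj y := horizontalProjL.contDiff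
  have hGli := locallyIntegrableOn_coe G
  have hgP := locallyIntegrableOn_inner_coe hPc.continuous G
  have hgJ := locallyIntegrableOn_inner_coe (contDiff_rotGen (n := ∞)).continuous G
  have hgE := locallyIntegrableOn_inner_coe (continuous_const (y := (eZ : ℝ³))) G
  have hGJli := locallyIntegrableOn_inner_coe (contDiff_rotGen (n := ∞)).continuous GJ
  have hGEli := locallyIntegrableOn_inner_coe (continuous_const (y := (eZ : ℝ³))) GE
  have hdivc : ContinuousOn (fun x => VectorCalculus.divergence h₁ x) (cylinderCell L) := by
    have h1 : ContDiffOn ℝ ∞ h₁ (cylinderCell L : Set ℝ³) := hh₁.smooth.mono cell_subset_K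
    have h2 : ContinuousOn (fderiv ℝ h₁) (cylinderCell L : Set ℝ³) :=
      h1.continuousOn_fderiv_of_isOpen (cylinderCell L).isOpen (by simp)
    have heq : (fun x => VectorCalculus.divergence h₁ x) = fun x => ∑ i, ⟪(EuclideanSpace.basisFun (Fin 3) ℝ i : ℝ³),
        fderiv ℝ h₁ x (EuclideanSpace.basisFun (Fin 3) ℝ i)⟫ :=
      funext fun x => divergence_eq_sum_inner_fderiv _ h₁ x
    rw [heq]
    exact continuousOn_finsetSum _ fun i _ => continuousOn_const.inner (h2.clm_apply continuousOn_const)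
  have hd1 : LocallyIntegrableOn (fun x => ‖horizontalProj x‖ ^ 2 * (VectorCalculus.divergence h₁ x - h₀ x))
      (cylinderCell L : Set ℝ³) volume :=
    ((contDiff_rsq.continuous.continuousOn).mul (hdivc.sub (hh₀.continuousOn.mono cell_subset_K))).locallyIntegrableOn
      (cylinderCell L).isOpen.measurableSet
  have hd3 : LocallyIntegrableOn (fun x => ‖horizontalProj x‖ ^ 2 * ⟪(eZ : ℝ³), (GE : ℝ³ → ℝ³) x⟫)
      (cylinderCell L : Set ℝ³) volume := by
    have hVc : Continuous fun x : ℝ³ => (‖horizontalProj x‖ ^ 2) • (eZ : ℝ³) :=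
      contDiff_rsq.continuous.smul continuous_const
    have h := locallyIntegrableOn_inner_coe hVc GE
    have hfun : (fun x : ℝ³ => ⟪(‖horizontalProj x‖ ^ 2) • (eZ : ℝ³), (GE : ℝ³ → ℝ³) x⟫) =
        fun x => ‖horizontalProj x‖ ^ 2 * ⟪(eZ : ℝ³), (GE : ℝ³ → ℝ³) x⟫ :=
      funext fun x => real_inner_smul_left _ _ _
    rw [hfun] at h
    exact h
  refine ⟨hgP, (hd1.sub hGJli).sub hd3, fun φ hφ => ?_⟩
  -- the test functions derived from `φ`
  set ρ : ℝ³ → ℝ := fun x => ‖horizontalProj x‖ ^ 2 with hρ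
  have hη : IsTestFunctionOn (cylinderCell L) fun x => φ x * ρ x := isTestFunctionOn_rsq_mul hφ
  have hφd : Differentiable ℝ φ := hφ.contDiff.differentiable (by simp)
  have hρd : Differentiable ℝ ρ := contDiff_rsq.differentiable (by simp)
  have hdη : ∀ x v, fderiv ℝ (fun x => φ x * ρ x) x v = fderiv ℝ φ x v * ρ x + φ x * (2 * ⟪horizontalProj x, v⟫) :=
    fun x v => by
    rw [fderiv_fun_mul (hφd x) (hρd x)]
    simp only [_root_.add_apply, _root_.FunLike.coe_smul, Pi.smul_apply, smul_eq_mul, hρ, fderiv_rsq_apply]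
    ring
  -- (W) the weak equation with `η = φρ`
  have hW := setIntegral_fderiv_coe_neumannGrad hL hh₀ hh₁ hmean hη
  rw [← hG] at hW
  -- (D) the divergence identity for `h₁` with `η`
  have hD := setIntegral_fderiv_apply_eq_neg_divergence (hh₁.smooth.mono cell_subset_K) hη
  -- (PJ) and (PE)
  have hPJ := hJ.integral_eq φ hφ
  simp only [divergence_rotGen_eq_zero, zero_mul, add_zero] at hPJ
  have hPE := hE.integral_eq _ hη
  simp only [HasWeakDerivAlong.divergence_const_field, zero_mul, add_zero] at hPE
  -- names of the basic integrals
  obtain ⟨A, hA⟩ : ∃ A : ℝ, A = ∫ x in (cylinderCell L : Set ℝ³), fderiv ℝ φ x (horizontalProj x) *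
      ⟪horizontalProj x, (G : ℝ³ → ℝ³) x⟫ := ⟨_, rfl⟩
  obtain ⟨B, hB⟩ : ∃ B : ℝ, B = ∫ x in (cylinderCell L : Set ℝ³), φ x * ⟪horizontalProj x, (G : ℝ³ → ℝ³) x⟫ := ⟨_, rfl⟩
  obtain ⟨C, hC⟩ : ∃ C : ℝ, C = ∫ x in (cylinderCell L : Set ℝ³), fderiv ℝ φ x (rotGen x) *
      ⟪rotGen x, (G : ℝ³ → ℝ³) x⟫ := ⟨_, rfl⟩
  obtain ⟨D', hD'⟩ : ∃ D' : ℝ, D' = ∫ x in (cylinderCell L : Set ℝ³), fderiv ℝ (fun x => φ x * ρ x) x eZ *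
      ⟪(eZ : ℝ³), (G : ℝ³ → ℝ³) x⟫ := ⟨_, rfl⟩
  -- split the left side of (W): `Dη(G) = Pφ gP + Jφ gJ + (∂_z η) gE + 2 φ gP`
  have hsplitW : ∫ x in (cylinderCell L : Set ℝ³), fderiv ℝ (fun x => φ x * ρ x) x ((G : ℝ³ → ℝ³) x) =
      A + C + D' + 2 * B := by
    have hpt : ∀ x, fderiv ℝ (fun x => φ x * ρ x) x ((G : ℝ³ → ℝ³) x) =
        fderiv ℝ φ x (horizontalProj x) * ⟪horizontalProj x, (G : ℝ³ → ℝ³) x⟫ +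
        fderiv ℝ φ x (rotGen x) * ⟪rotGen x, (G : ℝ³ → ℝ³) x⟫ +
        fderiv ℝ (fun x => φ x * ρ x) x eZ * ⟪(eZ : ℝ³), (G : ℝ³ → ℝ³) x⟫ +
        2 * (φ x * ⟪horizontalProj x, (G : ℝ³ → ℝ³) x⟫) := fun x => by
      rw [hdη, hdη]
      have hframe := congrArg (fderiv ℝ φ x) (rsq_smul_eq_frame x ((G : ℝ³ → ℝ³) x))
      rw [map_smul, map_add, map_add, map_smul, map_smul, map_smul] at hframe
      simp only [smul_eq_mul] at hframe
      have hz : ⟪horizontalProj x, (eZ : ℝ³)⟫ = 0 := by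
        rw [horizontalProj_apply_eq]; simp [inner, eZ_eq_single]
      rw [hz, mul_zero, mul_zero, add_zero, hρ]
      simp only at hframe ⊢
      linear_combination hframe
    simp_rw [hpt]
    have I1 := integrable_testFunction_mul (isTestFunctionOn_fderiv_apply_field hφ hPc) hgP
    have I2 := integrable_testFunction_mul (isTestFunctionOn_fderiv_apply_field hφ contDiff_rotGen) hgJ
    have I3 : Integrable (fun x => fderiv ℝ (fun x => φ x * ρ x) x eZ * ⟪(eZ : ℝ³), (G : ℝ³ → ℝ³) x⟫) (cellMeasure L) :=
      integrable_testFunction_mul (isTestFunctionOn_fderiv_apply_field hη (contDiff_const (c := (eZ : ℝ³)))) hgE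
    have I4 := (integrable_testFunction_mul hφ hgP).const_mul 2
    have I123 : Integrable (fun x => fderiv ℝ φ x (horizontalProj x) * ⟪horizontalProj x, (G : ℝ³ → ℝ³) x⟫ +
        fderiv ℝ φ x (rotGen x) * ⟪rotGen x, (G : ℝ³ → ℝ³) x⟫ +
        fderiv ℝ (fun x => φ x * ρ x) x eZ * ⟪(eZ : ℝ³), (G : ℝ³ → ℝ³) x⟫) (cellMeasure L) := (I1.add I2).add I3
    have I12 : Integrable (fun x => fderiv ℝ φ x (horizontalProj x) * ⟪horizontalProj x, (G : ℝ³ → ℝ³) x⟫ +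
        fderiv ℝ φ x (rotGen x) * ⟪rotGen x, (G : ℝ³ → ℝ³) x⟫) (cellMeasure L) := I1.add I2
    rw [integral_add I123 I4, integral_add I12 I3, integral_add I1 I2, integral_const_mul, hA, hB, hC, hD']
  -- (PE) in terms of `D'`
  have hPE' : D' = -∫ x in (cylinderCell L : Set ℝ³), (φ x * ρ x) * ⟪(eZ : ℝ³), (GE : ℝ³ → ℝ³) x⟫ := by
    rw [hD']
    simpa only [smul_eq_mul] using hPE
  have hPJ' : C = -∫ x in (cylinderCell L : Set ℝ³), φ x * ⟪rotGen x, (GJ : ℝ³ → ℝ³) x⟫ := by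
    rw [hC]
    simpa only [smul_eq_mul] using hPJ
  -- the goal: left side
  simp only [divergence_horizontalProj, smul_eq_mul]
  have hlhs : ∫ x in (cylinderCell L : Set ℝ³), (fderiv ℝ φ x (horizontalProj x) + 2 * φ x) *
      ⟪horizontalProj x, (G : ℝ³ → ℝ³) x⟫ = A + 2 * B := by
    have I1 := integrable_testFunction_mul (isTestFunctionOn_fderiv_apply_field hφ hPc) hgP
    have I4 := (integrable_testFunction_mul hφ hgP).const_mul 2
    rw [hA, hB, ← integral_const_mul, ← integral_add I1 I4]
    exact integral_congr_ae (Eventually.of_forall fun x => by ring)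
  rw [hlhs]
  -- the goal: right side, split into three integrals `X - Y - Z`
  have J1 := integrable_testFunction_mul hη ((hdivc.sub (hh₀.continuousOn.mono cell_subset_K)).locallyIntegrableOn
    (cylinderCell L).isOpen.measurableSet)
  have J2 := integrable_testFunction_mul hφ hGJli
  have J3 := integrable_testFunction_mul hη hGEli
  obtain ⟨X, hX⟩ : ∃ X : ℝ, X = ∫ x in (cylinderCell L : Set ℝ³), (φ x * ρ x) * (VectorCalculus.divergence h₁ x - h₀ x) :=
    ⟨_, rfl⟩
  obtain ⟨Y, hY⟩ : ∃ Y : ℝ, Y = ∫ x in (cylinderCell L : Set ℝ³), φ x * ⟪rotGen x, (GJ : ℝ³ → ℝ³) x⟫ := ⟨_, rfl⟩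
  obtain ⟨Z, hZ⟩ : ∃ Z : ℝ, Z = ∫ x in (cylinderCell L : Set ℝ³), (φ x * ρ x) * ⟪(eZ : ℝ³), (GE : ℝ³ → ℝ³) x⟫ :=
    ⟨_, rfl⟩
  have hXY : ∫ x in (cylinderCell L : Set ℝ³), ((φ x * ρ x) * (VectorCalculus.divergence h₁ x - h₀ x) -
      φ x * ⟪rotGen x, (GJ : ℝ³ → ℝ³) x⟫) = X - Y := by
    rw [hX, hY]; exact integral_sub J1 J2
  have hXYZ : ∫ x in (cylinderCell L : Set ℝ³), (((φ x * ρ x) * (VectorCalculus.divergence h₁ x - h₀ x) -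
      φ x * ⟪rotGen x, (GJ : ℝ³ → ℝ³) x⟫) - (φ x * ρ x) * ⟪(eZ : ℝ³), (GE : ℝ³ → ℝ³) x⟫) = (X - Y) - Z := by
    rw [← hXY, hZ]; exact integral_sub (J1.sub J2) J3
  have hrhs : ∫ x in (cylinderCell L : Set ℝ³), φ x * (ρ x * (VectorCalculus.divergence h₁ x - h₀ x) -
      ⟪rotGen x, (GJ : ℝ³ → ℝ³) x⟫ - ρ x * ⟪(eZ : ℝ³), (GE : ℝ³ → ℝ³) x⟫) = (X - Y) - Z := by
    rw [← hXYZ]; exact integral_congr_ae (Eventually.of_forall fun x => by ring)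
  rw [hrhs]
  -- `∫ h₀ η + ∫ Dη(h₁) = -X`
  have K1 := integrable_testFunction_mul hη (hdivc.locallyIntegrableOn (cylinderCell L).isOpen.measurableSet)
  have K2 := integrable_testFunction_mul hη ((hh₀.continuousOn.mono cell_subset_K).locallyIntegrableOn
    (cylinderCell L).isOpen.measurableSet)
  have hX' : X = (∫ x in (cylinderCell L : Set ℝ³), (φ x * ρ x) * VectorCalculus.divergence h₁ x) -
      ∫ x in (cylinderCell L : Set ℝ³), (φ x * ρ x) * h₀ x := by
    rw [hX, ← integral_sub K1 K2]; exact integral_congr_ae (Eventually.of_forall fun x => by ring)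
  have hW0a : ∫ x in (cylinderCell L : Set ℝ³), h₀ x * (φ x * ρ x) = ∫ x in (cylinderCell L : Set ℝ³), (φ x * ρ x) * h₀ x :=
    integral_congr_ae (Eventually.of_forall fun x => by ring)
  have hW0b : ∫ x in (cylinderCell L : Set ℝ³), VectorCalculus.divergence h₁ x * (φ x * ρ x) =
      ∫ x in (cylinderCell L : Set ℝ³), (φ x * ρ x) * VectorCalculus.divergence h₁ x :=
    integral_congr_ae (Eventually.of_forall fun x => by ring)
  rw [hW0a] at hW
  rw [hW0b] at hD
  linarith [hW, hsplitW, hD, hX', hPJ', hPE']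

/-! ### The radial weak derivatives of the tangential components -/

/-- **Commutation transfer**: if `q` has weak derivatives `g_A` along `P = x_h·∇` and `g_B` along a
smooth divergence-free field `B` whose classical derivative commutes with that of `P` on test
functions (`∂_B(∂_Pφ + 2φ) = ∂_P(∂_Bφ) + 2∂_Bφ`), and `g_A` has the weak `B`-derivative `k`, then
`g_B` has the weak `P`-derivative `k`: weakly, `P(Bq) = B(Pq)`. [folklore] -/
theorem hasWeakDerivAlong_horizontalProj_of_comm {q gA gB k : ℝ³ → ℝ} {B : ℝ³ → ℝ³} (hB : ContDiff ℝ ∞ B)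
    (hdivB : ∀ x, VectorCalculus.divergence B x = 0)
    (hcomm : ∀ φ : ℝ³ → ℝ, ContDiff ℝ ∞ φ → ∀ x,
      fderiv ℝ (fun y => fderiv ℝ φ y (horizontalProj y)) x (B x) = fderiv ℝ (fun y => fderiv ℝ φ y (B y)) x (horizontalProj x))
    (hqA : HasWeakDerivAlong (cylinderCell L) volume (fun y => horizontalProj y) q gA)
    (hqB : HasWeakDerivAlong (cylinderCell L) volume B q gB)
    (hAB : HasWeakDerivAlong (cylinderCell L) volume B gA k) :
    HasWeakDerivAlong (cylinderCell L) volume (fun y => horizontalProj y) gB k := by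
  refine ⟨hqB.locallyIntegrableOn_deriv, hAB.locallyIntegrableOn_deriv, fun φ hφ => ?_⟩
  have hPc : ContDiff ℝ ∞ fun y : ℝ³ => horizontalProj y := horizontalProjL.contDiff
  -- the test functions `ψ = Pφ + 2φ` and `θ = Bφ`
  have hψ := isTestFunctionOn_radialFactor hφ
  have hθ := isTestFunctionOn_fderiv_apply_field hφ hB
  -- Step A: `∫ ψ g_B = -∫ (Bψ) q`
  have hA := hqB.integral_eq _ hψ
  simp only [hdivB, zero_mul, add_zero, smul_eq_mul] at hA
  -- Step B: `Bψ = Pθ + 2θ` pointwise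
  have hBψ : ∀ x, fderiv ℝ (fun x => fderiv ℝ φ x (horizontalProj x) + 2 * φ x) x (B x) =
      fderiv ℝ (fun y => fderiv ℝ φ y (B y)) x (horizontalProj x) + 2 * fderiv ℝ φ x (B x) := fun x => by
    have hd1 : DifferentiableAt ℝ (fun x => fderiv ℝ φ x (horizontalProj x)) x :=
      ((isTestFunctionOn_fderiv_apply_field hφ hPc).contDiff.differentiable (by simp)) x
    have hd2 : DifferentiableAt ℝ (fun x => 2 * φ x) x :=
      ((hφ.contDiff.differentiable (by simp)) x).const_mul 2
    rw [fderiv_fun_add hd1 hd2, fderiv_const_mul ((hφ.contDiff.differentiable (by simp)) x)]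
    simp only [_root_.add_apply, _root_.FunLike.coe_smul, Pi.smul_apply, smul_eq_mul]
    rw [hcomm φ hφ.contDiff x]
  -- Step C: `∫ (Pθ + 2θ) q = -∫ θ g_A`
  have hC := hqA.integral_eq _ hθ
  simp only [divergence_horizontalProj, smul_eq_mul] at hC
  -- Step D: `∫ (Bφ) g_A = -∫ φ k`
  have hD := hAB.integral_eq φ hφ
  simp only [hdivB, zero_mul, add_zero, smul_eq_mul] at hD
  -- assemble
  simp only [divergence_horizontalProj, smul_eq_mul]
  have hA' := congrArg Neg.neg hA
  simp only [neg_neg] at hA'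
  rw [← hD, ← hA']
  have e1 : ∫ x in (cylinderCell L : Set ℝ³), fderiv ℝ (fun x => fderiv ℝ φ x (horizontalProj x) + 2 * φ x) x (B x) * q x =
      ∫ x in (cylinderCell L : Set ℝ³), (fderiv ℝ (fun y => fderiv ℝ φ y (B y)) x (horizontalProj x) +
        2 * fderiv ℝ φ x (B x)) * q x :=
    integral_congr_ae (Eventually.of_forall fun x => by simp only [hBψ])
  rw [e1, hC, neg_neg]

/-- `[J, P] = 0` on test functions: `∂_J(∂_Pφ) = ∂_P(∂_Jφ)`. [folklore] -/
theorem fderiv_P_J_comm {φ : ℝ³ → ℝ} (hφ : ContDiff ℝ ∞ φ) (x : ℝ³) :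
    fderiv ℝ (fun y => fderiv ℝ φ y (horizontalProj y)) x (rotGen x) =
      fderiv ℝ (fun y => fderiv ℝ φ y (rotGen y)) x (horizontalProj x) := by
  have hφ2 : ContDiff ℝ 2 φ := hφ.of_le (by norm_cast)
  have h := fderiv_fderiv_linear_comm hφ2 horizontalProjL rotGenL (fun y => ?_) x
  · exact h
  · show horizontalProj (rotGen y) = rotGen (horizontalProj y)
    rw [horizontalProj_rotGen, rotGen_horizontalProj]

/-- `[e_z, P] = 0` on test functions: `∂_z(∂_Pφ) = ∂_P(∂_zφ)`. [folklore] -/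
theorem fderiv_P_eZ_comm {φ : ℝ³ → ℝ} (hφ : ContDiff ℝ ∞ φ) (x : ℝ³) :
    fderiv ℝ (fun y => fderiv ℝ φ y (horizontalProj y)) x eZ =
      fderiv ℝ (fun y => fderiv ℝ φ y eZ) x (horizontalProj x) := by
  have hφ2 : ContDiff ℝ 2 φ := hφ.of_le (by norm_cast)
  have h := fderiv_fderiv_linear_const_comm hφ2 horizontalProjL eZ ?_ x
  · exact h
  · show horizontalProj eZ = 0
    ext i; fin_cases i <;> simp [horizontalProj_apply_eq, eZ_eq_single]

/-- **The radial weak derivative of `g_J = ⟪Jx, ∇q⟫`**: `(x_h·∇) g_J = ⟪x_h, ∇q[∂_J h₀, ∂_J h₁ − Jh₁]⟫`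
weakly on the open cell (`P(Jq) = J(Pq)` weakly, and `J(Pq) = J g_P` is the pairing of
`PeriodicCylinderNeumannWeakTangential`). [folklore] -/
theorem hasWeakDerivAlong_horizontalProj_inner_rotGen (hL : 0 < L) {h₀ : ℝ³ → ℝ} {h₁ : ℝ³ → ℝ³}
    (hh₀ : IsSmoothPeriodic L h₀) (hh₁ : IsSmoothPeriodic L h₁) :
    HasWeakDerivAlong (cylinderCell L) volume (fun y => horizontalProj y)
      (fun x => ⟪rotGen x, (((neumannGrad L (toCell L h₀) (toCell L h₁) : gradSpace L) :
        Lp ℝ³ 2 (cellMeasure L)) : ℝ³ → ℝ³) x⟫)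
      (fun x => ⟪horizontalProj x, (((neumannGrad L (toCell L (cylDeriv rotGen h₀))
        (toCell L (fun x => cylDeriv rotGen h₁ x - rotGen (h₁ x))) : gradSpace L) :
          Lp ℝ³ 2 (cellMeasure L)) : ℝ³ → ℝ³) x⟫) := by
  have hPc : ContDiff ℝ ∞ fun y : ℝ³ => horizontalProj y := horizontalProjL.contDiff
  have hq := hasWeakFDerivOn_potential hL (neumannGrad L (toCell L h₀) (toCell L h₁))
  have hqA := hq.hasWeakDerivAlong hPc
  have hqB := hq.hasWeakDerivAlong (contDiff_rotGen (n := ∞))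
  simp only [innerSL_apply_apply] at hqA hqB
  have hAB := hasWeakDerivAlong_rotGen_inner_neumannGrad hL hh₀ hh₁ hPc.continuous horizontalProj_rotZ zero_le_one
    (fun x hx => norm_horizontalProj_le_one hx)
  have h := hasWeakDerivAlong_horizontalProj_of_comm (contDiff_rotGen (n := ∞)) divergence_rotGen_eq_zero
    (fun φ hφ x => fderiv_P_J_comm hφ x) (hqA.congr_deriv (Eventually.of_forall fun x => real_inner_comm _ _))
    (hqB.congr_deriv (Eventually.of_forall fun x => real_inner_comm _ _)) hAB
  exact h

/-- **The radial weak derivative of `g_z = ⟪e_z, ∇q⟫`**: `(x_h·∇) g_z = ⟪x_h, ∇q[∂_z h₀, ∂_z h₁]⟫`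
weakly on the open cell. [folklore] -/
theorem hasWeakDerivAlong_horizontalProj_inner_eZ (hL : 0 < L) {h₀ : ℝ³ → ℝ} {h₁ : ℝ³ → ℝ³}
    (hh₀ : IsSmoothPeriodic L h₀) (hh₁ : IsSmoothPeriodic L h₁) :
    HasWeakDerivAlong (cylinderCell L) volume (fun y => horizontalProj y)
      (fun x => ⟪(eZ : ℝ³), (((neumannGrad L (toCell L h₀) (toCell L h₁) : gradSpace L) :
        Lp ℝ³ 2 (cellMeasure L)) : ℝ³ → ℝ³) x⟫)
      (fun x => ⟪horizontalProj x, (((neumannGrad L (toCell L (cylDeriv (fun _ => eZ) h₀))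
        (toCell L (cylDeriv (fun _ => eZ) h₁)) : gradSpace L) : Lp ℝ³ 2 (cellMeasure L)) : ℝ³ → ℝ³) x⟫) := by
  have hPc : ContDiff ℝ ∞ fun y : ℝ³ => horizontalProj y := horizontalProjL.contDiff
  have hq := hasWeakFDerivOn_potential hL (neumannGrad L (toCell L h₀) (toCell L h₁))
  have hqA := hq.hasWeakDerivAlong hPc
  have hqB := hq.hasWeakDerivAlong (contDiff_const (c := (eZ : ℝ³)))
  simp only [innerSL_apply_apply] at hqA hqB
  have hAB := hasWeakDerivAlong_eZ_inner_neumannGrad hL hh₀ hh₁ hPc fderiv_horizontalProj_apply_eZ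
  have h := hasWeakDerivAlong_horizontalProj_of_comm (contDiff_const (c := (eZ : ℝ³)))
    (fun x => HasWeakDerivAlong.divergence_const_field (eZ : ℝ³) x)
    (fun φ hφ x => fderiv_P_eZ_comm hφ x) (hqA.congr_deriv (Eventually.of_forall fun x => real_inner_comm _ _))
    (hqB.congr_deriv (Eventually.of_forall fun x => real_inner_comm _ _)) hAB
  exact h

end PeriodicCylinder

end Literature.Analysis.FluidPDE
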